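import Literature.MathematicalPhysics.QuantumFieldTheory.Balaban1983to89.B9B8KnitLandauTransfer
import Literature.MathematicalPhysics.QuantumFieldTheory.Balaban1983to89.B8Ineq159AtLettersY

/-!
# `Balaban1983to89.B9B8KnitNormsTransfer` — the (B)-line bond junction, file 3: THE NORMS (3.41) ∕ p. 86 ON THE TWO CARRIERS

statement-level skeleton of published theorems with citation tags; proofs where landed; nothing here is a claim about the
Yang–Mills mass gap

Sub-row G-B8-T2S «[B8] §3 Thm 2 TORUS SUPPLIER» (unit `lit-balaban-t2s-1`, gen 6), B-LINE 3 (the torus bond junction), after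
`B9B8KnitBondTransfer` (file 1: the carrier maps `descBd` ∕ `liftBd` and the letters `D`, `D*`, `Δ`, `curl`, `J = D*D` with their unit
factor `c_fη`) and `B9B8KnitLandauTransfer` (file 2: the Landau letter).  THIS FILE relates the two WEIGHTED SUPREMUM NORMS the (B)-line is
written in: def-Y's `Node00.wNormBY i α Ψ = msup (ℓ+1) i.k |c_f|⁻¹ α (block-level membership) Ψ` on the member's finite bond carrier
`FBondY i` ([4] (3.41) «|Ψ|₍α₎ = sup_j sup_{b ⊂ B_j} (Lʲη)^{−α}|Ψ(b)|», def-Y's lattice spacing `|c_f|⁻¹`), and the knit's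
`B8ScaledSupNorm.msup ∕ bondNorm L m η α` on `ℤ^{d+1}` ([Balaban1985RegularSpaces] p. 86, after (1.55): «|J|₍₋₃₎ = sup_j sup_{b∈Ω_j}
(Lʲη)³|J(b)|»), at the CONSTANT-LEVEL members of the catalogue (`∀ z, levY i z = n`: every block of the member has level `n`,
`B9B8KnitLetterTransfer.blk_level`) and at the torus datum of the knit (`Ω_j = T_η` for all `j`, [Balaban1985RegularSpaces] p. 77 «we admit the
case when some domains Ω_j are equal to T_η»), where both norms collapse to ONE weight times a plain supremum.

Sources: `[Balaban1985BackgroundPropagators]` ("[4]" of B8 = cell paper B9, CMP **99** 389–434) (3.41) p. 397, (3.47) p. 398, Thm 3.3 p. 399;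
`[Balaban1985RegularSpaces]` (B8, CMP **99** 75–102) p. 77 (domains, bond convention), (1.41) p. 83, (1.55), (1.58)–(1.59) p. 86.  Pages held as
`paper:balaban1985-cmp99-background-propagators` pp. 394–400 and `paper:balaban1985-cmp99-regular-spaces-gauge-fixing` pp. 82–88 (this seat, 2026-08-28).

WHAT IS PROVED (kernel, 0 sorry, theorems only; hypotheses displayed):
* §1 CONSTANT LEVEL (def-Y side, any datum `i` with `∀ z, levY i z = n`): `blkV1_level_eq` (every bond block has level `n`),
  `weight_level_mul_norm_le_wNormBY` («(Lⁿ|c_f|⁻¹)^{−α}‖Ψ(b)‖ ≤ |Ψ|₍α₎» at every bond), `norm_le_inv_weight_mul_wNormBY`,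
  `wNormBY_le_weight_level_mul` (a plain bound `‖Ψ(b)‖ ≤ c` gives `|Ψ|₍α₎ ≤ (Lⁿ|c_f|⁻¹)^{−α}·c`) — the norm IS one weight times the sup.
* §2 THE SUP DICTIONARY under file 1's carrier maps: `norm_liftBd_le` ∕ `norm_le_of_forall_norm_liftBd_le` (`liftBd` neither raises nor — by
  `transl 0 (rel 0 b₋) = b₋` — loses the supremum), `norm_descBd_le`, ★ `wNormBY_descBd_le` («‖A′‖ ≤ c on ℤ^{d+1} ⟹ |A′♭|₍α₎ ≤ w·c»),
  ★ `norm_le_of_wNormBY_descBd` (periodic `A′`: «|A′♭|₍α₎ ≤ C ⟹ ‖A′(x, μ)‖ ≤ w⁻¹·C» at EVERY `x ∈ ℤ^{d+1}`).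
* §3 THE KNIT SIDE AT A FULL TOP LEVEL: `weight_mono_of_nonpos` («(Lʲη)^{−α} ≤ (Lᵐη)^{−α}» for `j ≤ m`, `α ≤ 0`, `L ≥ 1`),
  ★ `msup_le_weight_top_mul` (`α ≤ 0`: a plain bound `‖f‖ ≤ c` gives `msup L m η α mem f ≤ (Lᵐη)^{−α}·c` for ANY membership),
  `bdd_of_forall_norm_le`, ★ `weight_top_mul_norm_le_msup` (membership at the top level `m` — automatic at `Ω_m = T_η` — gives the converse
  member inequality), and the `bondNorm` spellings `bondNorm_le_weight_top_mul` ∕ `weight_top_mul_norm_le_bondNorm_univ`.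
* §4 THE THREE (1.59) LETTERS AT THE SUB-ROW's DATA (`U := bgY i U₀`, `A := A′♭ = descBd i A′`, `U₀`, `A′` periodic with the member's period,
  `η ≠ 0`; file 1's ★★ `coCurlY_curlY_transl` ∕ `cdB_transl` ∕ `lapB_transl` by name): two-sided transfer of PLAIN suprema —
  `norm_Jcur_le_of_wNormBY` ∕ `wNormBY_coCurlY_curlY_descBd_le` (`|D*_U D_U A′♭|₍α₎` versus `sup ‖J(A′)‖`, factor `(c_fη)²`),
  `norm_covDerivFwd_le_of_wNormBY` ∕ `wNormBY_cdB_descBd_le` (factor `c_fη`), `norm_covLap_le_of_wNormBY` ∕ `wNormBY_lapB_descBd_le` (factor `(c_fη)²`),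
  `norm_le_of_wNormBY_descBd'` ∕ `wNormBY_descBd_le'` (the field itself).
* §5 UNITS (pure arithmetic of the weights, [4] p. 397 ∕ B8 p. 86): at a member with `c_f = L^{n+1}` (the catalogue's `(mem P₀ n).cf`,
  `B8Thm2TorusKnitCubeCore`), `weight_defY_eq` («(Lⁿ|c_f|⁻¹)^{−α} = L^{α}»), `scale_knit_eq` («Lⁿη = c_fη∕L»), and ★ `weight_defY_eq_mul_weight_knit`
  («(Lⁿ|c_f|⁻¹)^{−α} = (c_fη)^{α}·(Lⁿη)^{−α}»): with §4's factors `(c_fη)^{#derivatives}` the three (1.59)∕(3.47) inequalities carry THE SAME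
  constant `B₀` on both carriers (a `k`-derivative letter read at weight `α = −(k+1)` picks up `(c_fη)^{k+α} = (c_fη)^{−1}` on both sides).

HONEST SCOPE.  Bookkeeping of norms only: no inequality of [4] or B8 is proved here, no operator is inverted, nothing is averaged; the averaging
letter and the Landau letter are not touched (files 2, 4).  General coefficient algebra `𝔸`; general datum `i` under the displayed constant-level
hypothesis; the knit side for a general membership predicate (upper bounds) and for top-level membership (member bounds).  Count-neutral:
`B9P3PerAt` ∕ `B9P3ThreeAt` ∕ `stub_PV3A` NOT discharged; nothing continuum ∕ ℝ⁴ ∕ OS ∕ mass gap ∕ Clay — the Yang–Mills mass gap is NOT proved by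
any of this (Track A conditional rung).  No `sorry`, no `def`, no `… : Prop` fact, no `instance`, no `notation`.  NEW file; nothing landed is
modified; everything of files 1–2, r05's `B8Ineq159AtLettersY` §1 toolkit and r05-lineage `B8ScaledSupNorm` is used BY NAME.
-/

noncomputable section

namespace Literature.MathematicalPhysics.QuantumFieldTheory.Balaban1983to89.B9B8KnitNormsTransfer

open scoped BigOperators
open Node00
open B7Prop1Explicit renaming Site → LSite
open B7Prop1Explicit (e)
open B8Ineq132 (covDerivFwd BondTouches)
open B8Eq138LandauZd (covLap)
open B8Eq155JBound (Jcur)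
open B8ScaledSupNorm (msup weight Bdd bondNorm msup_le msup_nonneg weight_mul_norm_le_msup weight_nonneg weight_pos scale_pos)
open B12Ineq417Flat (shiftCfg)
open B10Eq27TorusAxialLog (transl transl_rel rel)
open B6KLevelCensusIndexV1 (KIdx)
open B6GlobalChartV1 (PV blkV1)
open B9B8KnitLetterTransfer (blk_level)
open B9B8KnitBondTransfer (liftBd liftBd_apply descBd descBd_apply liftBd_descBd bond_eq_transl_rel coCurlY_curlY_transl cdB_transl lapB_transl)
open B8Thm2TorusLettersPerOfKnit (bgY liftCfg_bgY)
open B8Ineq159AtLettersY (bdd_wNormBY weight_mul_norm_le_wNormBY wNormBY_nonneg wNormBY_le_of_weight_mul_norm_le)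

variable {d ℓ : ℕ} {hd : 1 ≤ d + 1} {hL : Odd (ℓ + 1) ∧ 1 < ℓ + 1} {b₀ b₁ : ℝ}
variable {𝔸 : Type} [NormedRing 𝔸] [NormedAlgebra ℂ 𝔸] [CompleteSpace 𝔸]
variable (i : KIdx d ℓ hd hL b₀ b₁)

/-! ## §1 Constant level: def-Y's `|Ψ|₍α₎` is one weight times a plain supremum -/

section Level

variable {n : ℕ}

omit [NormedRing 𝔸] [NormedAlgebra ℂ 𝔸] [CompleteSpace 𝔸] in
/-- at a constant-level member every bond block has level `n`. [cite: Balaban1984PropagatorsII, (2.3)–(2.4) p.224; Balaban1985BackgroundPropagators, (3.41) p.397, bookkeeping] -/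
theorem blkV1_level_eq (hlev : ∀ z : SiteY i, levY i z = n) (x : FBondY i) : (blkV1 i.hN i.D x).1.1 = n :=
  blk_level i hlev (blkV1 i.hN i.D x)

omit [NormedAlgebra ℂ 𝔸] [CompleteSpace 𝔸] in
/-- «(Lⁿ|c_f|⁻¹)^{−α}‖Ψ(b)‖ ≤ |Ψ|₍α₎» at every bond of a constant-level member. [cite: Balaban1985BackgroundPropagators, (3.41) p.397] -/
theorem weight_level_mul_norm_le_wNormBY (hlev : ∀ z : SiteY i, levY i z = n) (α : ℝ) (Ψ : FBondY i → 𝔸) (x : FBondY i) :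
    weight (ℓ + 1) |i.cf|⁻¹ α n * ‖Ψ x‖ ≤ wNormBY i α Ψ := by
  have h := weight_mul_norm_le_wNormBY i α Ψ x
  rwa [blkV1_level_eq i hlev x] at h

omit [NormedRing 𝔸] [NormedAlgebra ℂ 𝔸] [CompleteSpace 𝔸] in
/-- the constant-level weight is positive (`c_f ≠ 0`). [cite: Balaban1985BackgroundPropagators, (3.41) p.397, bookkeeping] -/
theorem weight_level_pos (α : ℝ) (n : ℕ) : 0 < weight (ℓ + 1) |i.cf|⁻¹ α n :=
  weight_pos (Nat.succ_le_succ (Nat.zero_le ℓ)) (inv_pos.2 (abs_pos.2 i.hcf)) α n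

omit [NormedAlgebra ℂ 𝔸] [CompleteSpace 𝔸] in
/-- «‖Ψ(b)‖ ≤ (Lⁿ|c_f|⁻¹)^{α}|Ψ|₍α₎», i.e. the plain supremum is controlled by the weighted norm, at a constant-level member.
[cite: Balaban1985BackgroundPropagators, (3.41) p.397; Balaban1985RegularSpaces, (1.41) p.83 (the pointwise reading)] -/
theorem norm_le_inv_weight_mul_wNormBY (hlev : ∀ z : SiteY i, levY i z = n) (α : ℝ) (Ψ : FBondY i → 𝔸) (x : FBondY i) :
    ‖Ψ x‖ ≤ (weight (ℓ + 1) |i.cf|⁻¹ α n)⁻¹ * wNormBY i α Ψ := by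
  rw [le_inv_mul_iff₀ (weight_level_pos i α n)]
  exact weight_level_mul_norm_le_wNormBY i hlev α Ψ x

omit [NormedAlgebra ℂ 𝔸] [CompleteSpace 𝔸] in
/-- a plain bound `‖Ψ(b)‖ ≤ c` (`c ≥ 0`) gives `|Ψ|₍α₎ ≤ (Lⁿ|c_f|⁻¹)^{−α}·c` at a constant-level member. [cite: Balaban1985BackgroundPropagators, (3.41) p.397] -/
theorem wNormBY_le_weight_level_mul (hlev : ∀ z : SiteY i, levY i z = n) {α c : ℝ} (hc : 0 ≤ c) {Ψ : FBondY i → 𝔸}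
    (h : ∀ x : FBondY i, ‖Ψ x‖ ≤ c) : wNormBY i α Ψ ≤ weight (ℓ + 1) |i.cf|⁻¹ α n * c := by
  refine wNormBY_le_of_weight_mul_norm_le i (mul_nonneg (weight_level_pos i α n).le hc) fun x => ?_
  rw [blkV1_level_eq i hlev x]
  exact mul_le_mul_of_nonneg_left (h x) (weight_level_pos i α n).le

end Level

/-! ## §2 The supremum under the carrier maps `liftBd` ∕ `descBd` of file 1 -/

section Carrier

variable {n : ℕ}

omit [NormedAlgebra ℂ 𝔸] [CompleteSpace 𝔸] in
/-- the periodic lift does not raise the supremum. [cite: Balaban1985RegularSpaces, p.77 («Ω_j = T_η»), bookkeeping] -/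
theorem norm_liftBd_le {Ψ : FBondY i → 𝔸} {c : ℝ} (h : ∀ x : FBondY i, ‖Ψ x‖ ≤ c) (z : LSite (d + 1)) (κ : Fin (d + 1)) :
    ‖liftBd i Ψ z κ‖ ≤ c := by
  rw [liftBd_apply]
  exact h _

omit [NormedAlgebra ℂ 𝔸] [CompleteSpace 𝔸] in
/-- the periodic lift does not lose the supremum either: every member bond is `⟨transl 0 (rel 0 b₋), dir⟩`. [cite: Balaban1985RegularSpaces, p.77, (1.3) p.77, bookkeeping] -/
theorem norm_le_of_forall_norm_liftBd_le {Ψ : FBondY i → 𝔸} {c : ℝ} (h : ∀ (z : LSite (d + 1)) (κ : Fin (d + 1)), ‖liftBd i Ψ z κ‖ ≤ c)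
    (x : FBondY i) : ‖Ψ x‖ ≤ c := by
  have hx := h (rel (0 : Site (PV d ℓ i.m i.K hd hL) 0) x.src) x.dir
  rwa [liftBd_apply, ← bond_eq_transl_rel i x] at hx

omit [NormedAlgebra ℂ 𝔸] [CompleteSpace 𝔸] in
/-- the descent does not raise the supremum. [cite: Balaban1985RegularSpaces, p.77, bookkeeping] -/
theorem norm_descBd_le {A : LSite (d + 1) → Fin (d + 1) → 𝔸} {c : ℝ} (h : ∀ (z : LSite (d + 1)) (κ : Fin (d + 1)), ‖A z κ‖ ≤ c)
    (x : FBondY i) : ‖descBd i A x‖ ≤ c := by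
  rw [descBd_apply]
  exact h _ _

omit [NormedAlgebra ℂ 𝔸] [CompleteSpace 𝔸] in
/-- ★ «‖A′‖ ≤ c on ℤ^{d+1} ⟹ |A′♭|₍α₎ ≤ (Lⁿ|c_f|⁻¹)^{−α}·c» at a constant-level member — the road from the knit's pointwise hypotheses
(e.g. (1.41) «|A′| ≤ α₂(Lʲη)⁻¹») to def-Y's weighted norms. [cite: Balaban1985RegularSpaces, (1.41) p.83; Balaban1985BackgroundPropagators, (3.41) p.397] -/
theorem wNormBY_descBd_le (hlev : ∀ z : SiteY i, levY i z = n) {α c : ℝ} (hc : 0 ≤ c) {A : LSite (d + 1) → Fin (d + 1) → 𝔸}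
    (h : ∀ (z : LSite (d + 1)) (κ : Fin (d + 1)), ‖A z κ‖ ≤ c) : wNormBY i α (descBd i A) ≤ weight (ℓ + 1) |i.cf|⁻¹ α n * c :=
  wNormBY_le_weight_level_mul i hlev hc (norm_descBd_le i h)

omit [NormedAlgebra ℂ 𝔸] [CompleteSpace 𝔸] in
/-- ★ «|Ψ|₍α₎ ≤ C ⟹ ‖Ψ♯(z, κ)‖ ≤ (Lⁿ|c_f|⁻¹)^{α}·C at every z ∈ ℤ^{d+1}» — the road from def-Y's weighted conclusions back to the knit's plain
suprema. [cite: Balaban1985BackgroundPropagators, (3.41) p.397; Balaban1985RegularSpaces, (1.59) p.86] -/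
theorem norm_liftBd_le_of_wNormBY_le (hlev : ∀ z : SiteY i, levY i z = n) {α C : ℝ} {Ψ : FBondY i → 𝔸} (hΨ : wNormBY i α Ψ ≤ C)
    (z : LSite (d + 1)) (κ : Fin (d + 1)) : ‖liftBd i Ψ z κ‖ ≤ (weight (ℓ + 1) |i.cf|⁻¹ α n)⁻¹ * C := by
  rw [liftBd_apply]
  exact (norm_le_inv_weight_mul_wNormBY i hlev α Ψ _).trans
    (mul_le_mul_of_nonneg_left hΨ (inv_nonneg.2 (weight_level_pos i α n).le))

omit [NormedAlgebra ℂ 𝔸] [CompleteSpace 𝔸] in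
/-- ★ the same for a PERIODIC knit field read through its descent: «|A′♭|₍α₎ ≤ C ⟹ ‖A′(z, κ)‖ ≤ (Lⁿ|c_f|⁻¹)^{α}·C» (`A′♭♯ = A′`, file 1).
[cite: Balaban1985BackgroundPropagators, (3.41) p.397; Balaban1985RegularSpaces, (1.3) p.77, (1.59) p.86] -/
theorem norm_le_of_wNormBY_descBd_le (hlev : ∀ z : SiteY i, levY i z = n) {α C : ℝ} {A : LSite (d + 1) → Fin (d + 1) → 𝔸}
    (hA : ∀ (x : LSite (d + 1)) (j : Fin (d + 1)), A (x + (((PV d ℓ i.m i.K hd hL).sitesPerDir 0 : ℕ) : ℤ) • e j) = A x)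
    (hΨ : wNormBY i α (descBd i A) ≤ C) (z : LSite (d + 1)) (κ : Fin (d + 1)) :
    ‖A z κ‖ ≤ (weight (ℓ + 1) |i.cf|⁻¹ α n)⁻¹ * C := by
  have h := norm_liftBd_le_of_wNormBY_le i hlev hΨ z κ
  rwa [liftBd_descBd i hA] at h

end Carrier

/-! ## §3 The knit side at a full top level: `msup` ∕ `bondNorm` at `Ω_m = T_η` is one weight times a plain supremum -/

section Knit

variable {ι E : Type*} [SeminormedAddCommGroup E]

omit i in
/-- «(Lʲη)^{−α} ≤ (Lᵐη)^{−α}» for `j ≤ m`, `α ≤ 0`, `L ≥ 1`, `η > 0`: at non-positive exponents the top level carries the largest weight.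
[cite: Balaban1985RegularSpaces, p.86 (definition after (1.55))] -/
theorem weight_mono_of_nonpos {L : ℕ} (hL : 1 ≤ L) {η : ℝ} (hη : 0 < η) {α : ℝ} (hα : α ≤ 0) {j m : ℕ} (hjm : j ≤ m) :
    weight L η α j ≤ weight L η α m := by
  unfold weight
  have hL' : (1 : ℝ) ≤ L := by exact_mod_cast hL
  exact Real.rpow_le_rpow (scale_pos hL hη j).le
    (mul_le_mul_of_nonneg_right (pow_le_pow_right₀ hL' hjm) hη.le) (neg_nonneg.2 hα)

omit i in
/-- ★ at `α ≤ 0` a plain bound `‖f‖ ≤ c` (`c ≥ 0`) gives `msup L m η α mem f ≤ (Lᵐη)^{−α}·c`, whatever the membership predicate.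
[cite: Balaban1985RegularSpaces, p.86 (definition after (1.55))] -/
theorem msup_le_weight_top_mul {L : ℕ} (hL : 1 ≤ L) {η : ℝ} (hη : 0 < η) {α : ℝ} (hα : α ≤ 0) {m : ℕ} {mem : ℕ → ι → Prop}
    {f : ι → E} {c : ℝ} (hc : 0 ≤ c) (h : ∀ b, ‖f b‖ ≤ c) : msup L m η α mem f ≤ weight L η α m * c :=
  msup_le (mul_nonneg (weight_nonneg L hη.le α m) hc) fun _ hj b _ =>
    mul_le_mul (weight_mono_of_nonpos hL hη hα hj) (h b) (norm_nonneg _) (weight_nonneg L hη.le α m)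

omit i in
/-- at `α ≤ 0` a plain bound witnesses r05's boundedness side condition `Bdd`. [cite: Balaban1985RegularSpaces, p.86 (definition after (1.55))] -/
theorem bdd_of_forall_norm_le {L : ℕ} (hL : 1 ≤ L) {η : ℝ} (hη : 0 < η) {α : ℝ} (hα : α ≤ 0) {m : ℕ} {mem : ℕ → ι → Prop}
    {f : ι → E} {c : ℝ} (h : ∀ b, ‖f b‖ ≤ c) : Bdd L m η α mem f :=
  ⟨weight L η α m * c, fun _ hj b _ =>
    mul_le_mul (weight_mono_of_nonpos hL hη hα hj) (h b) (norm_nonneg _) (weight_nonneg L hη.le α m)⟩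

omit i in
/-- ★ membership at the top level `m` (automatic when `Ω_m = T_η`) puts `(Lᵐη)^{−α}‖f(b)‖` below the norm (bounded family).
[cite: Balaban1985RegularSpaces, p.86 (definition after (1.55)), p.77 («Ω_j = T_η»)] -/
theorem weight_top_mul_norm_le_msup {L m : ℕ} {η α : ℝ} {mem : ℕ → ι → Prop} {f : ι → E} (hB : Bdd L m η α mem f) {b : ι}
    (hb : mem m b) : weight L η α m * ‖f b‖ ≤ msup L m η α mem f :=
  weight_mul_norm_le_msup hB le_rfl hb

omit i in
/-- the `bondNorm` spelling of `msup_le_weight_top_mul`: `‖J‖ ≤ c` pointwise gives `|J|₍α₎ ≤ (Lᵐη)^{−α}·c` (`α ≤ 0`), any domains.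
[cite: Balaban1985RegularSpaces, p.86 (definition after (1.55))] -/
theorem bondNorm_le_weight_top_mul {L : ℕ} (hL : 1 ≤ L) {η : ℝ} (hη : 0 < η) {α : ℝ} (hα : α ≤ 0) {m : ℕ}
    {Ω : ℕ → Set (LSite (d + 1))} {J : LSite (d + 1) → Fin (d + 1) → E} {c : ℝ} (hc : 0 ≤ c) (h : ∀ x μ, ‖J x μ‖ ≤ c) :
    bondNorm L m η α Ω J ≤ weight L η α m * c :=
  msup_le_weight_top_mul hL hη hα hc fun b => h b.1 b.2

omit i in
/-- ★ at the torus datum (`Ω_m = T_η`): `(Lᵐη)^{−α}‖J(x, μ)‖ ≤ |J|₍α₎` at EVERY bond, for a pointwise-bounded `J` and `α ≤ 0`.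
[cite: Balaban1985RegularSpaces, p.86 (definition after (1.55)), p.77 («Ω_j = T_η»)] -/
theorem weight_top_mul_norm_le_bondNorm_univ {L : ℕ} (hL : 1 ≤ L) {η : ℝ} (hη : 0 < η) {α : ℝ} (hα : α ≤ 0) {m : ℕ}
    {Ω : ℕ → Set (LSite (d + 1))} (hΩ : Ω m = Set.univ) {J : LSite (d + 1) → Fin (d + 1) → E} {c : ℝ} (h : ∀ x μ, ‖J x μ‖ ≤ c)
    (x : LSite (d + 1)) (μ : Fin (d + 1)) : weight L η α m * ‖J x μ‖ ≤ bondNorm L m η α Ω J := by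
  unfold bondNorm
  refine weight_top_mul_norm_le_msup (f := fun b : LSite (d + 1) × Fin (d + 1) => J b.1 b.2)
    (bdd_of_forall_norm_le hL hη hα fun b => h b.1 b.2) (b := (x, μ)) ?_
  show BondTouches (Ω m) x μ
  rw [hΩ]
  exact Or.inl (Set.mem_univ x)

end Knit

/-! ## §4 The three (1.59) letters at the sub-row's data: plain suprema across the carriers -/

section SubRow

variable {n : ℕ} (η : ℝ)
variable {U₀ : LSite (d + 1) → Fin (d + 1) → 𝔸ˣ} {A' : LSite (d + 1) → Fin (d + 1) → 𝔸}

/-- ★ «|D*_U D_U A′♭|₍α₎ ≤ C ⟹ ‖(c_fη)²·J(A′)(x, κ)‖ ≤ (Lⁿ|c_f|⁻¹)^{α}·C at every x ∈ ℤ^{d+1}» — the `|J|`-shaped member read back on the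
knit's carrier (file 1: `(D*_U D_U A′♭)♯ = (c_fη)²·J(A′)`). [cite: Balaban1985RegularSpaces, (1.55), (1.59) p.86; Balaban1985BackgroundPropagators, (3.41) p.397, (3.47) p.398] -/
theorem norm_Jcur_le_of_wNormBY (hlev : ∀ z : SiteY i, levY i z = n) (hη : η ≠ 0)
    (hU₀ : ∀ μ : Fin (d + 1), shiftCfg ((((PV d ℓ i.m i.K hd hL).sitesPerDir 0 : ℕ) : ℤ) • e μ) U₀ = U₀)
    (hA' : ∀ (x : LSite (d + 1)) (j : Fin (d + 1)), A' (x + (((PV d ℓ i.m i.K hd hL).sitesPerDir 0 : ℕ) : ℤ) • e j) = A' x)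
    {α C : ℝ} (hC : wNormBY i α (coCurlY i (bgY i U₀) (curlY i (bgY i U₀) (descBd i A'))) ≤ C) (x : LSite (d + 1)) (κ : Fin (d + 1)) :
    ‖(((i.cf * η : ℝ)) : ℂ) ^ 2 • Jcur η U₀ A' κ x‖ ≤ (weight (ℓ + 1) |i.cf|⁻¹ α n)⁻¹ * C := by
  have h := norm_liftBd_le_of_wNormBY_le i hlev hC x κ
  rwa [liftBd_apply, coCurlY_curlY_transl i η (bgY i U₀) hη (descBd i A') x κ, liftCfg_bgY i hU₀, liftBd_descBd i hA'] at h

/-- ★ the converse road: «‖(c_fη)²·J(A′)‖ ≤ c on ℤ^{d+1} ⟹ |D*_U D_U A′♭|₍α₎ ≤ (Lⁿ|c_f|⁻¹)^{−α}·c». [cite: Balaban1985RegularSpaces, (1.55), (1.59) p.86; Balaban1985BackgroundPropagators, (3.41) p.397] -/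
theorem wNormBY_coCurlY_curlY_descBd_le (hlev : ∀ z : SiteY i, levY i z = n) (hη : η ≠ 0)
    (hU₀ : ∀ μ : Fin (d + 1), shiftCfg ((((PV d ℓ i.m i.K hd hL).sitesPerDir 0 : ℕ) : ℤ) • e μ) U₀ = U₀)
    (hA' : ∀ (x : LSite (d + 1)) (j : Fin (d + 1)), A' (x + (((PV d ℓ i.m i.K hd hL).sitesPerDir 0 : ℕ) : ℤ) • e j) = A' x)
    {α c : ℝ} (hc : 0 ≤ c) (h : ∀ (x : LSite (d + 1)) (κ : Fin (d + 1)), ‖(((i.cf * η : ℝ)) : ℂ) ^ 2 • Jcur η U₀ A' κ x‖ ≤ c) :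
    wNormBY i α (coCurlY i (bgY i U₀) (curlY i (bgY i U₀) (descBd i A'))) ≤ weight (ℓ + 1) |i.cf|⁻¹ α n * c := by
  refine wNormBY_le_weight_level_mul i hlev hc (norm_le_of_forall_norm_liftBd_le i fun x κ => ?_)
  rw [liftBd_apply, coCurlY_curlY_transl i η (bgY i U₀) hη (descBd i A') x κ, liftCfg_bgY i hU₀, liftBd_descBd i hA']
  exact h x κ

/-- ★ «|∇_{U,ν} A′♭|₍α₎ ≤ C ⟹ ‖(c_fη)·(D^η_{U₀,ν}A′_κ)(x)‖ ≤ (Lⁿ|c_f|⁻¹)^{α}·C» — the gradient member of (1.59) read back on the knit's carrier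
(file 1: `(∇_{U,ν}A′♭)♯_κ = (c_fη)·D^η_{U₀,ν}A′_κ`). [cite: Balaban1985RegularSpaces, (1.1) p.76, (1.59) p.86; Balaban1985BackgroundPropagators, (3.3) p.390, (3.41) p.397] -/
theorem norm_covDerivFwd_le_of_wNormBY (hlev : ∀ z : SiteY i, levY i z = n) (hη : η ≠ 0)
    (hU₀ : ∀ μ : Fin (d + 1), shiftCfg ((((PV d ℓ i.m i.K hd hL).sitesPerDir 0 : ℕ) : ℤ) • e μ) U₀ = U₀)
    (hA' : ∀ (x : LSite (d + 1)) (j : Fin (d + 1)), A' (x + (((PV d ℓ i.m i.K hd hL).sitesPerDir 0 : ℕ) : ℤ) • e j) = A' x)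
    (ν : Fin (d + 1)) {α C : ℝ} (hC : wNormBY i α (cdB i (bgY i U₀) ν (descBd i A')) ≤ C) (x : LSite (d + 1)) (κ : Fin (d + 1)) :
    ‖(((i.cf * η : ℝ)) : ℂ) • covDerivFwd η U₀ ν (fun w => A' w κ) x‖ ≤ (weight (ℓ + 1) |i.cf|⁻¹ α n)⁻¹ * C := by
  have h := norm_liftBd_le_of_wNormBY_le i hlev hC x κ
  rwa [liftBd_apply, cdB_transl i η (bgY i U₀) hη ν (descBd i A') x κ, liftCfg_bgY i hU₀, liftBd_descBd i hA'] at h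

/-- ★ the converse road for the gradient member. [cite: Balaban1985RegularSpaces, (1.1) p.76, (1.59) p.86; Balaban1985BackgroundPropagators, (3.41) p.397] -/
theorem wNormBY_cdB_descBd_le (hlev : ∀ z : SiteY i, levY i z = n) (hη : η ≠ 0)
    (hU₀ : ∀ μ : Fin (d + 1), shiftCfg ((((PV d ℓ i.m i.K hd hL).sitesPerDir 0 : ℕ) : ℤ) • e μ) U₀ = U₀)
    (hA' : ∀ (x : LSite (d + 1)) (j : Fin (d + 1)), A' (x + (((PV d ℓ i.m i.K hd hL).sitesPerDir 0 : ℕ) : ℤ) • e j) = A' x)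
    (ν : Fin (d + 1)) {α c : ℝ} (hc : 0 ≤ c)
    (h : ∀ (x : LSite (d + 1)) (κ : Fin (d + 1)), ‖(((i.cf * η : ℝ)) : ℂ) • covDerivFwd η U₀ ν (fun w => A' w κ) x‖ ≤ c) :
    wNormBY i α (cdB i (bgY i U₀) ν (descBd i A')) ≤ weight (ℓ + 1) |i.cf|⁻¹ α n * c := by
  refine wNormBY_le_weight_level_mul i hlev hc (norm_le_of_forall_norm_liftBd_le i fun x κ => ?_)
  rw [liftBd_apply, cdB_transl i η (bgY i U₀) hη ν (descBd i A') x κ, liftCfg_bgY i hU₀, liftBd_descBd i hA']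
  exact h x κ

/-- ★ «|Δ_U A′♭|₍α₎ ≤ C ⟹ ‖(c_fη)²·(Δ^η_{U₀}A′_κ)(x)‖ ≤ (Lⁿ|c_f|⁻¹)^{α}·C» — the Laplacian member of (1.59) read back on the knit's carrier
(file 1: `(Δ_U A′♭)♯_κ = (c_fη)²·Δ^η_{U₀}A′_κ`). [cite: Balaban1985RegularSpaces, (1.59) p.86; Balaban1985BackgroundPropagators, (3.23) p.394, (3.41) p.397] -/
theorem norm_covLap_le_of_wNormBY (hlev : ∀ z : SiteY i, levY i z = n) (hη : η ≠ 0)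
    (hU₀ : ∀ μ : Fin (d + 1), shiftCfg ((((PV d ℓ i.m i.K hd hL).sitesPerDir 0 : ℕ) : ℤ) • e μ) U₀ = U₀)
    (hA' : ∀ (x : LSite (d + 1)) (j : Fin (d + 1)), A' (x + (((PV d ℓ i.m i.K hd hL).sitesPerDir 0 : ℕ) : ℤ) • e j) = A' x)
    {α C : ℝ} (hC : wNormBY i α (lapB i (bgY i U₀) (descBd i A')) ≤ C) (x : LSite (d + 1)) (κ : Fin (d + 1)) :
    ‖(((i.cf * η : ℝ)) : ℂ) ^ 2 • covLap η U₀ (fun w => A' w κ) x‖ ≤ (weight (ℓ + 1) |i.cf|⁻¹ α n)⁻¹ * C := by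
  have h := norm_liftBd_le_of_wNormBY_le i hlev hC x κ
  rwa [liftBd_apply, lapB_transl i η (bgY i U₀) hη (descBd i A') x κ, liftCfg_bgY i hU₀, liftBd_descBd i hA'] at h

/-- ★ the converse road for the Laplacian member. [cite: Balaban1985RegularSpaces, (1.59) p.86; Balaban1985BackgroundPropagators, (3.23) p.394, (3.41) p.397] -/
theorem wNormBY_lapB_descBd_le (hlev : ∀ z : SiteY i, levY i z = n) (hη : η ≠ 0)
    (hU₀ : ∀ μ : Fin (d + 1), shiftCfg ((((PV d ℓ i.m i.K hd hL).sitesPerDir 0 : ℕ) : ℤ) • e μ) U₀ = U₀)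
    (hA' : ∀ (x : LSite (d + 1)) (j : Fin (d + 1)), A' (x + (((PV d ℓ i.m i.K hd hL).sitesPerDir 0 : ℕ) : ℤ) • e j) = A' x)
    {α c : ℝ} (hc : 0 ≤ c) (h : ∀ (x : LSite (d + 1)) (κ : Fin (d + 1)), ‖(((i.cf * η : ℝ)) : ℂ) ^ 2 • covLap η U₀ (fun w => A' w κ) x‖ ≤ c) :
    wNormBY i α (lapB i (bgY i U₀) (descBd i A')) ≤ weight (ℓ + 1) |i.cf|⁻¹ α n * c := by
  refine wNormBY_le_weight_level_mul i hlev hc (norm_le_of_forall_norm_liftBd_le i fun x κ => ?_)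
  rw [liftBd_apply, lapB_transl i η (bgY i U₀) hη (descBd i A') x κ, liftCfg_bgY i hU₀, liftBd_descBd i hA']
  exact h x κ

end SubRow

/-! ## §5 Units: the two weights at a catalogue member `c_f = L^{n+1}` -/

section Units

variable {n : ℕ}

omit [NormedRing 𝔸] [NormedAlgebra ℂ 𝔸] [CompleteSpace 𝔸] in
/-- at a member with `c_f = L^{n+1}` def-Y's scale `Lⁿ·|c_f|⁻¹` is `L⁻¹`. [cite: Balaban1985BackgroundPropagators, p.389 («η = L^{−k}»), (3.41) p.397, bookkeeping] -/
theorem scale_defY_eq (hcf : i.cf = (((ℓ + 1 : ℕ) : ℝ)) ^ (n + 1)) :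
    (((ℓ + 1 : ℕ) : ℝ)) ^ n * |i.cf|⁻¹ = ((((ℓ + 1 : ℕ) : ℝ)))⁻¹ := by
  have hL : (0 : ℝ) < ((ℓ + 1 : ℕ) : ℝ) := by positivity
  rw [hcf, abs_of_pos (pow_pos hL _), pow_succ, mul_inv, ← mul_assoc, mul_inv_cancel₀ (pow_ne_zero _ hL.ne'), one_mul]

omit [NormedRing 𝔸] [NormedAlgebra ℂ 𝔸] [CompleteSpace 𝔸] in
/-- ★ «(Lⁿ|c_f|⁻¹)^{−α} = L^{α}»: def-Y's weight at a member with `c_f = L^{n+1}` is the pure number `L^{α}`. [cite: Balaban1985BackgroundPropagators, (3.41) p.397, bookkeeping] -/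
theorem weight_defY_eq (hcf : i.cf = (((ℓ + 1 : ℕ) : ℝ)) ^ (n + 1)) (α : ℝ) :
    weight (ℓ + 1) |i.cf|⁻¹ α n = (((ℓ + 1 : ℕ) : ℝ)) ^ α := by
  have hL : (0 : ℝ) ≤ ((ℓ + 1 : ℕ) : ℝ) := by positivity
  unfold weight
  rw [scale_defY_eq i hcf, Real.inv_rpow hL, ← Real.rpow_neg hL, neg_neg]

omit [NormedRing 𝔸] [NormedAlgebra ℂ 𝔸] [CompleteSpace 𝔸] i in
/-- «Lⁿη = (c_fη)∕L» when `c_f = L^{n+1}`: the knit's scale in terms of file 1's unit factor. [cite: Balaban1985RegularSpaces, p.86 (definition after (1.55)), bookkeeping] -/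
theorem scale_knit_eq {cf : ℝ} (hcf : cf = (((ℓ + 1 : ℕ) : ℝ)) ^ (n + 1)) (η : ℝ) :
    (((ℓ + 1 : ℕ) : ℝ)) ^ n * η = cf * η / (((ℓ + 1 : ℕ) : ℝ)) := by
  have hL : (0 : ℝ) < ((ℓ + 1 : ℕ) : ℝ) := by positivity
  rw [hcf, pow_succ]
  field_simp

omit [NormedRing 𝔸] [NormedAlgebra ℂ 𝔸] [CompleteSpace 𝔸] in
/-- ★ **THE SAME `B₀` ON BOTH CARRIERS**: «(Lⁿ|c_f|⁻¹)^{−α} = (c_fη)^{α}·(Lⁿη)^{−α}» at a member with `c_f = L^{n+1}`, `η > 0` — def-Y's weight is the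
knit's weight times `(c_fη)^{α}`; with §4's factors `(c_fη)^{k}` on a `k`-derivative letter read at `α = −(k+1)` both sides of a (1.59) ∕ (3.47)
inequality scale by the common factor `(c_fη)^{−1}`. [cite: Balaban1985RegularSpaces, (1.59) p.86; Balaban1985BackgroundPropagators, (3.41) p.397, (3.47) p.398] -/
theorem weight_defY_eq_mul_weight_knit (hcf : i.cf = (((ℓ + 1 : ℕ) : ℝ)) ^ (n + 1)) {η : ℝ} (hη : 0 < η) (α : ℝ) :
    weight (ℓ + 1) |i.cf|⁻¹ α n = (i.cf * η) ^ α * weight (ℓ + 1) η α n := by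
  have hL : (0 : ℝ) < ((ℓ + 1 : ℕ) : ℝ) := by positivity
  have hcf0 : 0 < i.cf := by rw [hcf]; exact pow_pos hL _
  rw [weight_defY_eq i hcf]
  unfold weight
  rw [scale_knit_eq hcf η, Real.div_rpow (mul_pos hcf0 hη).le hL.le, Real.rpow_neg (mul_pos hcf0 hη).le, Real.rpow_neg hL.le,
    div_eq_mul_inv, inv_inv, ← mul_assoc, mul_inv_cancel₀ (Real.rpow_pos_of_pos (mul_pos hcf0 hη) α).ne', one_mul]

end Units

end Literature.MathematicalPhysics.QuantumFieldTheory.Balaban1983to89.B9B8KnitNormsTransfer
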